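import Summits.Ventures.HSemireg.WedgeHankelRecurrenceGaussChebyshevCMixedLevelIdeal

/-!
# Venture HSemireg — **THE MIXED-LEVEL IDEAL OF `T`: `(T_m − 1, T_n + 1) = (T_g + 1)` IF `m ∕ g` IS EVEN AND `= (2, T_g − 1) = (2, T_g + 1)` IF `m ∕ g` IS ODD, AS IDEALS OF `R[X]` FOR EVERY COMMUTATIVE
# RING** (`g = gcd(m,n)`; the Gauss–Lobatto-type level set `{T_m = 1}` against `{T_n = −1}`), completing with N495 ∕ N496 the `2 × 2` table of `±1`-level ideals of `T`; from N497 pushed along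
# `X ↦ 2X`, cancelling `2` over `ℤ` and base-changing; integer readings **`gcd(T_m(a) − 1, T_n(a) + 1) = |T_g(a) + 1|`** resp. **`= gcd(2, T_g(a) − 1)`**

HONEST FRAMING. Part of the Lean index of the computation cell `pub-hsemireg` (seat p10 gen 48, Sunday typer «UNIFORM-IN-n»).  Polynomial ideal algebra only; no variety, no cohomology theory, no sheaf,
no Ext group and no semiregularity map is constructed here; nothing here says that HC / HC_CM / HC_AV holds; no Literature fact (unproved `Prop`) is declared or used.  Custodian versions as in
`WedgeHankelSiegelIdeal` (1/3).
SOURCES (cited).  T. J. Rivlin, *Chebyshev Polynomials* (1990), §1.2, Ch. 4; J. C. Mason, D. C. Handscomb, *Chebyshev Polynomials* (2003), §1.2.3–1.2.4.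
PROOF TYPED HERE.  N497 `chebyshevC_sub_two_add_two_span_pair_even ∕ _odd`; N495 `span_pair_eq_span_singleton_of_mul_left`; N496 `span_pair_eq_span_pair_of_mul_left`; N476 `int_gcd_eq_natAbs_of_span_pair_eq`,
`int_gcd_eq_of_span_pair_eq`; Mathlib `Polynomial.compRingHom`, `C_comp_two_mul_X`, `Polynomial.mapRingHom`, `map_T`, `Ideal.map_span`, `Ideal.span_pair_add_right_mul`.
DEDUP DISCLOSURE (`rg -n 'chebyshevT_sub_one_add_one_span_pair|span_pair_two_chebyshevT|chebyshevT_int_eval_sub_one_add_one_gcd' Summits Literature HarnessLib`, 2026-09-04): 0 hits for the 6 names below.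

WHAT IS IN THE TREE.  N476, N495, N496, N497.
THIS FILE (namespace `Summit.Ventures.HSemireg.Wedge.HankelOuter` continued; CHAINED on N497; 0 definitions):
* §1263 `chebyshevT_two_mul_sub_one_add_one_span_pair_int`, **`chebyshevT_sub_one_add_one_span_pair_even`**, **`chebyshevT_sub_one_add_one_span_pair_odd`**, `span_pair_two_chebyshevT_sub_one`,
  **`chebyshevT_int_eval_sub_one_add_one_gcd_even`**, **`chebyshevT_int_eval_sub_one_add_one_gcd_odd`**.
CAVEATS.  Nothing Ext-side.  New names only.
-/

open Module Polynomial
open scoped Matrix Polynomial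

namespace Summit.Ventures.HSemireg.Wedge.HankelOuter

/-! ## §1263. `(T_m − 1, T_n + 1)` in every `R[X]` -/

/-- Over `ℤ`: `(2(T_m − 1), 2(T_n + 1))` is `(2(T_g + 1))` if `m ∕ g` is even and `(4, 2(T_g − 1))` if `m ∕ g` is odd (N497 along `X ↦ 2X`). [this file, §1263] -/
theorem chebyshevT_two_mul_sub_one_add_one_span_pair_int (m n : ℕ) :
    (Even (m / Nat.gcd m n) →
      Ideal.span {2 * (Polynomial.Chebyshev.T ℤ (m : ℤ) - 1), 2 * (Polynomial.Chebyshev.T ℤ (n : ℤ) + 1)} = Ideal.span {2 * (Polynomial.Chebyshev.T ℤ (Nat.gcd m n : ℤ) + 1)}) ∧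
    (Odd (m / Nat.gcd m n) →
      Ideal.span {2 * (Polynomial.Chebyshev.T ℤ (m : ℤ) - 1), 2 * (Polynomial.Chebyshev.T ℤ (n : ℤ) + 1)} = Ideal.span {2 * 2, 2 * (Polynomial.Chebyshev.T ℤ (Nat.gcd m n : ℤ) - 1)}) := by
  have hc1 : ∀ k : ℤ, Polynomial.compRingHom (2 * Polynomial.X) (Polynomial.Chebyshev.C ℤ k + 2) = 2 * (Polynomial.Chebyshev.T ℤ k + 1) := fun k => by
    rw [Polynomial.coe_compRingHom_apply, add_comp, Polynomial.Chebyshev.C_comp_two_mul_X, ofNat_comp]; simp only [Nat.cast_ofNat]; ring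
  have hc2 : ∀ k : ℤ, Polynomial.compRingHom (2 * Polynomial.X) (Polynomial.Chebyshev.C ℤ k - 2) = 2 * (Polynomial.Chebyshev.T ℤ k - 1) := fun k => by
    rw [Polynomial.coe_compRingHom_apply, sub_comp, Polynomial.Chebyshev.C_comp_two_mul_X, ofNat_comp]; simp only [Nat.cast_ofNat]; ring
  have h4 : Polynomial.compRingHom (2 * Polynomial.X) (4 : ℤ[X]) = 2 * 2 := by rw [map_ofNat]; norm_num
  constructor
  · intro hm
    have h := congrArg (Ideal.map (Polynomial.compRingHom (2 * Polynomial.X : ℤ[X]))) (chebyshevC_sub_two_add_two_span_pair_even (R := ℤ) (n := n) hm)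
    rwa [Ideal.map_span, Ideal.map_span, Set.image_pair, Set.image_singleton, hc2, hc1, hc1] at h
  · intro hm
    have h := congrArg (Ideal.map (Polynomial.compRingHom (2 * Polynomial.X : ℤ[X]))) (chebyshevC_sub_two_add_two_span_pair_odd (R := ℤ) (n := n) hm)
    rwa [Ideal.map_span, Ideal.map_span, Set.image_pair, Set.image_pair, hc2, hc1, hc2, h4] at h

/-- **`(T_m − 1, T_n + 1) = (T_{gcd(m,n)} + 1)` in `R[X]` for every commutative ring `R`, when `m ∕ gcd(m,n)` is even.** [Rivlin §1.2; this file, §1263] -/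
theorem chebyshevT_sub_one_add_one_span_pair_even {R : Type*} [CommRing R] {m n : ℕ} (hm : Even (m / Nat.gcd m n)) :
    Ideal.span {Polynomial.Chebyshev.T R (m : ℤ) - 1, Polynomial.Chebyshev.T R (n : ℤ) + 1} = Ideal.span {Polynomial.Chebyshev.T R (Nat.gcd m n : ℤ) + 1} := by
  have hZ := span_pair_eq_span_singleton_of_mul_left (two_ne_zero : (2 : ℤ[X]) ≠ 0) ((chebyshevT_two_mul_sub_one_add_one_span_pair_int m n).1 hm)
  have h := congrArg (Ideal.map (Polynomial.mapRingHom (Int.castRingHom R))) hZ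
  rwa [Ideal.map_span, Ideal.map_span, Set.image_pair, Set.image_singleton, map_sub, map_add, map_add, map_one, Polynomial.coe_mapRingHom, Polynomial.Chebyshev.map_T,
    Polynomial.Chebyshev.map_T, Polynomial.Chebyshev.map_T] at h

/-- **`(T_m − 1, T_n + 1) = (2, T_{gcd(m,n)} − 1)` in `R[X]` for every commutative ring `R`, when `m ∕ gcd(m,n)` is odd.** [this file, §1263] -/
theorem chebyshevT_sub_one_add_one_span_pair_odd {R : Type*} [CommRing R] {m n : ℕ} (hm : Odd (m / Nat.gcd m n)) :
    Ideal.span {Polynomial.Chebyshev.T R (m : ℤ) - 1, Polynomial.Chebyshev.T R (n : ℤ) + 1} = Ideal.span {2, Polynomial.Chebyshev.T R (Nat.gcd m n : ℤ) - 1} := by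
  have hZ := span_pair_eq_span_pair_of_mul_left (two_ne_zero : (2 : ℤ[X]) ≠ 0) ((chebyshevT_two_mul_sub_one_add_one_span_pair_int m n).2 hm)
  have h := congrArg (Ideal.map (Polynomial.mapRingHom (Int.castRingHom R))) hZ
  rwa [Ideal.map_span, Ideal.map_span, Set.image_pair, Set.image_pair, map_sub, map_add, map_sub, map_one, map_ofNat, Polynomial.coe_mapRingHom, Polynomial.Chebyshev.map_T,
    Polynomial.Chebyshev.map_T, Polynomial.Chebyshev.map_T] at h

/-- `(2, T_g − 1) = (2, T_g + 1)`. [bookkeeping; this file, §1263] -/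
theorem span_pair_two_chebyshevT_sub_one {R : Type*} [CommRing R] (k : ℤ) :
    Ideal.span {(2 : R[X]), Polynomial.Chebyshev.T R k - 1} = Ideal.span {2, Polynomial.Chebyshev.T R k + 1} := by
  rw [Ideal.span_pair_comm, show Polynomial.Chebyshev.T R k - 1 = (Polynomial.Chebyshev.T R k + 1) + 2 * (-1) by ring, Ideal.span_pair_add_right_mul, Ideal.span_pair_comm]

/-- **`gcd(T_m(a) − 1, T_n(a) + 1) = |T_{gcd(m,n)}(a) + 1|`** for every integer `a`, when `m ∕ gcd(m,n)` is even. [this file, §1263] -/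
theorem chebyshevT_int_eval_sub_one_add_one_gcd_even (a : ℤ) {m n : ℕ} (hm : Even (m / Nat.gcd m n)) :
    Int.gcd ((Polynomial.Chebyshev.T ℤ (m : ℤ)).eval a - 1) ((Polynomial.Chebyshev.T ℤ (n : ℤ)).eval a + 1) = ((Polynomial.Chebyshev.T ℤ (Nat.gcd m n : ℤ)).eval a + 1).natAbs := by
  have hev1 : ∀ k : ℕ, Polynomial.evalRingHom a (Polynomial.Chebyshev.T ℤ (k : ℤ) - 1) = (Polynomial.Chebyshev.T ℤ (k : ℤ)).eval a - 1 := fun k => by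
    rw [map_sub, map_one, Polynomial.coe_evalRingHom]
  have hev2 : ∀ k : ℕ, Polynomial.evalRingHom a (Polynomial.Chebyshev.T ℤ (k : ℤ) + 1) = (Polynomial.Chebyshev.T ℤ (k : ℤ)).eval a + 1 := fun k => by
    rw [map_add, map_one, Polynomial.coe_evalRingHom]
  have h := congrArg (Ideal.map (Polynomial.evalRingHom a)) (chebyshevT_sub_one_add_one_span_pair_even (R := ℤ) (n := n) hm)
  rw [Ideal.map_span, Ideal.map_span, Set.image_pair, Set.image_singleton, hev1, hev2, hev2] at h
  exact int_gcd_eq_natAbs_of_span_pair_eq h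

/-- **`gcd(T_m(a) − 1, T_n(a) + 1) = gcd(2, T_{gcd(m,n)}(a) − 1)`** for every integer `a`, when `m ∕ gcd(m,n)` is odd. [this file, §1263] -/
theorem chebyshevT_int_eval_sub_one_add_one_gcd_odd (a : ℤ) {m n : ℕ} (hm : Odd (m / Nat.gcd m n)) :
    Int.gcd ((Polynomial.Chebyshev.T ℤ (m : ℤ)).eval a - 1) ((Polynomial.Chebyshev.T ℤ (n : ℤ)).eval a + 1) = Int.gcd 2 ((Polynomial.Chebyshev.T ℤ (Nat.gcd m n : ℤ)).eval a - 1) := by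
  have hev1 : ∀ k : ℕ, Polynomial.evalRingHom a (Polynomial.Chebyshev.T ℤ (k : ℤ) - 1) = (Polynomial.Chebyshev.T ℤ (k : ℤ)).eval a - 1 := fun k => by
    rw [map_sub, map_one, Polynomial.coe_evalRingHom]
  have hev2 : ∀ k : ℕ, Polynomial.evalRingHom a (Polynomial.Chebyshev.T ℤ (k : ℤ) + 1) = (Polynomial.Chebyshev.T ℤ (k : ℤ)).eval a + 1 := fun k => by
    rw [map_add, map_one, Polynomial.coe_evalRingHom]
  have h := congrArg (Ideal.map (Polynomial.evalRingHom a)) (chebyshevT_sub_one_add_one_span_pair_odd (R := ℤ) (n := n) hm)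
  rw [Ideal.map_span, Ideal.map_span, Set.image_pair, Set.image_pair, hev1, hev2, hev1, map_ofNat] at h
  exact int_gcd_eq_of_span_pair_eq h

end Summit.Ventures.HSemireg.Wedge.HankelOuter
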